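import Literature.Computability.Cryptography.RegevSamplerArith
import Literature.Algebra.EuclideanLattices.GapCVPCoNPComplete
import Literature.Algebra.EuclideanLattices.RegevUSVPInput
import Literature.Geometry.DiscreteGeometry.SeparatedSets
import HarnessLib

/-!
# Regev's one-copy sampler: the size of the dual basis

Topic `Literature/Computability/Cryptography`; sequel of `RegevSamplerArith.lean` (`adjugate_col_eq`: the column
`j` of `adj B` is `det B · b∨ⱼ`), `GapCVPCoNPComplete.lean` (`FarCert.natAbs_adjugate_le`: Hadamard-type bound
`|adj B i k| ≤ n!·(max M 1)ⁿ`) and `RegevUSVPInput.lean` (`RegevRoutine.natAbs_entry_lt`: entries are below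
`2^{|code|}`). The precision parameters of the sampler of Regev (J. ACM 56 (2009), art. 34, Lemma 3.14: the
residue width `ℓ_R` with `R = 2^{ℓ_R}`, the rounding width `ℓ_Y`) must dominate `Σⱼ ‖b∨ⱼ‖` (hypotheses `hRdec`,
`hyr` and the smallness of `Y = t R⁻¹ Σ‖b∨‖` in `RegevSamplerMachine.tvDist_machineCirc_le`); this file bounds the
dual basis by the SIZE of the instance:

* `one_le_abs_det` — `1 ≤ |det B|` for a nonsingular integer basis;
* **`norm_dualVec_le`** — `‖b∨ⱼ‖ ≤ √n · n! · (max M 1)ⁿ` when the entries of `B` are at most `M`;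
* `norm_dualVec_le_two_pow`, `sum_norm_dualVec_le_two_pow` — with `M = 2^{|code of B|}`:
  `Σⱼ ‖b∨ⱼ‖ ≤ n · √n · n! · 2^{n·|code|}`, a quantity of bit size polynomial in the input length.

Everything is proved; no definition, no named fact is introduced.

## References

* O. Regev, *On lattices, learning with errors, random linear codes, and cryptography*, J. ACM 56
  (2009), art. 34, Lemma 3.14 (proof: precision of the registers), §2 p. 11 [Regev2009].
* D. Micciancio, S. Goldwasser, *Complexity of Lattice Problems*, Kluwer 2002, Ch. 1 §1.1 (Cramer's rule,
  Hadamard's bound), §1.2 (size of an instance) [MicciancioGoldwasser2002].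
-/

noncomputable section

open Matrix Finset

namespace Literature.Computability.Cryptography

namespace Regev2009

namespace SamplerArith

open Literature.Algebra.EuclideanLattices Literature.Algebra.EuclideanLattices.Regev2009 Peikert2009
open Literature.Geometry.DiscreteGeometry.CubePacking

variable (I : LatticeInstance) [hZ : IsZLattice ℝ I.lattice]

/-- **`1 ≤ |det B|`** for the nonsingular integer basis of the instance. [cite: MicciancioGoldwasser2002, Ch. 1 §1.1] -/
theorem one_le_abs_det : (1 : ℝ) ≤ |(I.basis.det : ℝ)| := by
  rw [← Int.cast_abs]
  exact_mod_cast Int.one_le_abs (isNonsingular_of_isZLattice I)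

/-- **The dual vector is a column of the adjugate over the determinant**: `b∨ⱼ = (det B)⁻¹ · (adj B)_{·j}`.
[cite: MicciancioGoldwasser2002, Ch. 1 §1.1 (Cramer)] -/
theorem dualVec_eq_inv_det_smul (j : Fin I.n) :
    dualVec I j = (I.basis.det : ℝ)⁻¹ • intVecToEuclidean I.n (fun i => I.basis.adjugate i j) := by
  have hdet : (I.basis.det : ℝ) ≠ 0 := by exact_mod_cast isNonsingular_of_isZLattice I
  rw [show intVecToEuclidean I.n (fun i => I.basis.adjugate i j) =
      (WithLp.toLp 2 fun i => ((I.basis.adjugate i j : ℤ) : ℝ) : EuclideanSpace ℝ (Fin I.n)) from rfl,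
    adjugate_col_eq, smul_smul, inv_mul_cancel₀ hdet, one_smul]

/-- **Hadamard-type size of the dual basis**: if `|B i k| ≤ M` then `‖b∨ⱼ‖ ≤ √n · n! · (max M 1)ⁿ`.
[cite: MicciancioGoldwasser2002, Ch. 1 §1.1 (Cramer, Hadamard)] [cite: Regev2009, Lemma 3.14 (proof)] -/
theorem norm_dualVec_le {M : ℕ} (hM : ∀ i k, (I.basis i k).natAbs ≤ M) (j : Fin I.n) :
    ‖dualVec I j‖ ≤ Real.sqrt I.n * ((I.n.factorial * (max M 1) ^ I.n : ℕ) : ℝ) := by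
  have hK : ∀ i, |I.basis.adjugate i j| ≤ ((I.n.factorial * (max M 1) ^ I.n : ℕ) : ℤ) := fun i => by
    rw [Int.abs_eq_natAbs]
    exact_mod_cast FarCert.natAbs_adjugate_le I.basis hM i j
  rw [dualVec_eq_inv_det_smul, norm_smul, norm_inv, Real.norm_eq_abs]
  calc |(I.basis.det : ℝ)|⁻¹ * ‖intVecToEuclidean I.n fun i => I.basis.adjugate i j‖
      ≤ 1 * (Real.sqrt I.n * ((I.n.factorial * (max M 1) ^ I.n : ℕ) : ℝ)) :=
        mul_le_mul (inv_le_one_of_one_le₀ (one_le_abs_det I)) (norm_intVecToEuclidean_le hK) (norm_nonneg _) zero_le_one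
    _ = _ := one_mul _

/-- **Size of the dual basis from the code of the instance**: `‖b∨ⱼ‖ ≤ √n · n! · 2^{n·|code B|}`.
[cite: MicciancioGoldwasser2002, Ch. 1 §1.2] [cite: Regev2009, Lemma 3.14 (proof)] -/
theorem norm_dualVec_le_two_pow (j : Fin I.n) :
    ‖dualVec I j‖ ≤ Real.sqrt I.n * ((I.n.factorial * (2 ^ I.encode.length) ^ I.n : ℕ) : ℝ) := by
  have h := norm_dualVec_le I (M := 2 ^ I.encode.length) (fun i k => (RegevRoutine.natAbs_entry_lt I i k).le) j
  rwa [max_eq_left Nat.one_le_two_pow] at h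

/-- **`Σⱼ ‖b∨ⱼ‖ ≤ n · √n · n! · 2^{n·|code B|}`.** [cite: Regev2009, Lemma 3.14 (proof)] -/
theorem sum_norm_dualVec_le_two_pow :
    ∑ j, ‖dualVec I j‖ ≤ I.n * (Real.sqrt I.n * ((I.n.factorial * (2 ^ I.encode.length) ^ I.n : ℕ) : ℝ)) := by
  calc ∑ j, ‖dualVec I j‖ ≤ ∑ _j : Fin I.n, Real.sqrt I.n * ((I.n.factorial * (2 ^ I.encode.length) ^ I.n : ℕ) : ℝ) :=
        sum_le_sum fun j _ => norm_dualVec_le_two_pow I j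
    _ = _ := by rw [sum_const, card_univ, Fintype.card_fin, nsmul_eq_mul]

/-- The same bound with `√n ≤ n`: `Σⱼ ‖b∨ⱼ‖ ≤ n² · n! · 2^{n·|code B|}`, a natural number. [folklore] -/
theorem sum_norm_dualVec_le_nat :
    ∑ j, ‖dualVec I j‖ ≤ ((I.n * I.n * (I.n.factorial * (2 ^ I.encode.length) ^ I.n) : ℕ) : ℝ) := by
  refine (sum_norm_dualVec_le_two_pow I).trans ?_
  have hs : Real.sqrt I.n ≤ I.n := by
    rcases Nat.eq_zero_or_pos I.n with h | h
    · simp [h]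
    · rw [Real.sqrt_le_left (Nat.cast_nonneg _)]
      exact_mod_cast (le_self_pow (by omega : 1 ≤ I.n) two_ne_zero : I.n ≤ I.n ^ 2)
  push_cast
  rw [mul_assoc (I.n : ℝ) (I.n : ℝ)]
  exact mul_le_mul_of_nonneg_left (mul_le_mul_of_nonneg_right hs (by positivity)) (Nat.cast_nonneg _)

end SamplerArith

end Regev2009

end Literature.Computability.Cryptography

end
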